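import Mathlib.Topology.Homotopy.HomotopyGroup
import HarnessLib

/-!
# Maps of the cylinder `I × Iᴹ` as paths of generalized loops

Topic `Literature/AlgebraicTopology/Homotopy`. Mathlib identifies `(|M|+1)`-dimensional
generalized loops with loops in the space `Ω^M X x` of `|M|`-dimensional ones
(`GenLoop.toLoop`, `GenLoop.fromLoop`, `GenLoop.homotopicTo`, `GenLoop.homotopicFrom` in
`Mathlib/Topology/Homotopy/HomotopyGroup.lean`), which is how `π_{n+1}(X, x) ≅ π₁(Ω^M X x, const)`
is obtained. This file extends the dictionary from *loops* to *paths with a free initial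
point*, as needed for relative homotopy arguments (Hatcher, *Algebraic Topology* (2002), §4.1,
pp. 343–344: maps `(Iⁿ, ∂Iⁿ, Jⁿ⁻¹) → (X, A, x₀)` and the compression criterion), all PROVED:

* `Literature.AlgebraicTopology.Homotopy.GenLoopPath.jSet M`: the part `J = {1} × Iᴹ ∪ I × ∂Iᴹ` (top and walls) of the
  boundary of the cylinder `I × Iᴹ`;
* for a map `u : I × Iᴹ → X` with `u(J) = {x}`: the slices `slice u hu t ∈ Ω^M X x`
  (`y ↦ u (t, y)`) and the path `toPath u hu : Path (slice u hu 0) const` in `Ω^M X x`;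
* conversely `ofPath γ : C(I × Iᴹ, X)` for a path `γ` in `Ω^M X x` (uncurrying), with
  `toPath (ofPath γ) = γ` pointwise and `ofPath (toPath u) = u`;
* `homotopicRel_toPath` / `homotopicRel_of_toPath`: `u ≃ v` rel the whole boundary
  `∂(I × Iᴹ) = {0, 1} × Iᴹ ∪ I × ∂Iᴹ` iff the slice paths are homotopic rel `{0, 1}` as maps
  `I → Ω^M X x` (the analogue of `GenLoop.homotopicTo`/`homotopicFrom`);
* `genLoop_homotopic_iff_joined`: two generalized loops are homotopic rel `∂Iᴹ` iff they are
  joined by a path in `Ω^M X x`, so that `π_M(X, x)` is the set of path components of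
  `Ω^M X x` (Hatcher p. 340 for `n = 1`; folklore).

No change of basepoint, no group structure is used or defined here.

## References

* A. Hatcher, *Algebraic Topology*, CUP (2002), §4.1, pp. 340–344. [HatcherAT2002]
-/

noncomputable section

open Set unitInterval Function
open scoped Topology Topology.Homotopy

namespace Literature.AlgebraicTopology.Homotopy

namespace GenLoopPath

variable {M : Type*} {X : Type*} [TopologicalSpace X] {x : X}

/-- The top-and-walls part `J = {1} × Iᴹ ∪ I × ∂Iᴹ` of the boundary of the cylinder `I × Iᴹ`
(Hatcher's `Jⁿ⁻¹`, p. 343, with the free face at `t = 0`). [cite: HatcherAT2002, §4.1 p. 343] -/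
def jSet (M : Type*) : Set (I × (M → I)) := {p | p.1 = 1 ∨ p.2 ∈ Cube.boundary M}

/-- Membership in `jSet`. [folklore] -/
theorem mem_jSet {p : I × (M → I)} : p ∈ jSet M ↔ p.1 = 1 ∨ p.2 ∈ Cube.boundary M := Iff.rfl

/-- The whole boundary `{0, 1} × Iᴹ ∪ I × ∂Iᴹ` of the cylinder. [folklore] -/
def cylBd (M : Type*) : Set (I × (M → I)) := {p | p.1 = 0 ∨ p.1 = 1 ∨ p.2 ∈ Cube.boundary M}

/-- Membership in `cylBd`. [folklore] -/
theorem mem_cylBd {p : I × (M → I)} :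
    p ∈ cylBd M ↔ p.1 = 0 ∨ p.1 = 1 ∨ p.2 ∈ Cube.boundary M := Iff.rfl

/-- `J` is part of the boundary of the cylinder. [folklore] -/
theorem jSet_subset_cylBd : jSet M ⊆ cylBd M := fun _ hp => Or.inr hp

/-! ### Slices and the path of slices -/

section Slices

variable (u : C(I × (M → I), X)) (hu : ∀ p ∈ jSet M, u p = x)

/-- The slice `y ↦ u (t, y)` of a map of the cylinder sending `J` to `x`, as a generalized loop
at `x` (the walls go to `x`). [folklore] -/
def slice (t : I) : Ω^ M X x := ⟨u.curry t, fun y hy => hu (t, y) (Or.inr hy)⟩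

/-- Pointwise formula for `slice`. [folklore] -/
@[simp]
theorem slice_apply (t : I) (y : M → I) : slice u hu t y = u (t, y) := rfl

/-- The slices depend continuously on `t` (currying). [folklore] -/
theorem continuous_slice : Continuous (slice u hu : I → Ω^ M X x) :=
  u.curry.continuous.subtype_mk _

/-- The top slice is the constant loop. [folklore] -/
theorem slice_one : slice u hu 1 = GenLoop.const := by
  ext y
  exact hu (1, y) (Or.inl rfl)

/-- **The path of slices** of `u : (I × Iᴹ, J) → (X, x)` in `Ω^M X x`, from the bottom face
`slice u hu 0` to the constant loop (the analogue of `GenLoop.toLoop` for a free bottom face).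
[folklore] -/
def toPath : Path (slice u hu 0) (GenLoop.const : Ω^ M X x) where
  toFun := slice u hu
  continuous_toFun := continuous_slice u hu
  source' := rfl
  target' := slice_one u hu

/-- Pointwise formula for `toPath`. [folklore] -/
@[simp]
theorem toPath_apply (t : I) : toPath u hu t = slice u hu t := rfl

end Slices

/-! ### Uncurrying a path of generalized loops -/

section OfPath

variable {p q : Ω^ M X x}

/-- **The map of the cylinder defined by a path of generalized loops** (uncurrying; the analogue
of `GenLoop.fromLoop`). [folklore] -/
def ofPath (γ : Path p q) : C(I × (M → I), X) :=
  (ContinuousMap.comp ⟨Subtype.val, continuous_subtype_val⟩ γ.toContinuousMap).uncurry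

/-- Pointwise formula for `ofPath`. [folklore] -/
@[simp]
theorem ofPath_apply (γ : Path p q) (t : I) (y : M → I) : ofPath γ (t, y) = γ t y := rfl

/-- `ofPath γ` sends the walls to `x`. [folklore] -/
theorem ofPath_apply_of_mem_boundary (γ : Path p q) (t : I) {y : M → I}
    (hy : y ∈ Cube.boundary M) : ofPath γ (t, y) = x := (γ t).2 y hy

/-- The bottom face of `ofPath γ` is `p`. [folklore] -/
theorem ofPath_apply_zero (γ : Path p q) (y : M → I) : ofPath γ (0, y) = p y := by
  simp

/-- The top face of `ofPath γ` is `q`. [folklore] -/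
theorem ofPath_apply_one (γ : Path p q) (y : M → I) : ofPath γ (1, y) = q y := by
  simp

/-- A path ending at the constant loop uncurries to a map sending `J` to `x`. [folklore] -/
theorem ofPath_jSet (γ : Path p (GenLoop.const : Ω^ M X x)) :
    ∀ r ∈ jSet M, ofPath γ r = x := by
  rintro ⟨t, y⟩ (ht | hy)
  · dsimp only at ht
    subst ht
    simp
  · exact ofPath_apply_of_mem_boundary γ t hy

/-- `toPath ∘ ofPath = id` (pointwise in `t`). [folklore] -/
@[simp]
theorem toPath_ofPath (γ : Path p (GenLoop.const : Ω^ M X x)) (t : I) :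
    toPath (ofPath γ) (ofPath_jSet γ) t = γ t := by
  ext y
  rfl

/-- The bottom slice of `ofPath γ` is its source. [folklore] -/
theorem slice_ofPath_zero (γ : Path p (GenLoop.const : Ω^ M X x)) :
    slice (ofPath γ) (ofPath_jSet γ) 0 = p := by
  ext y
  simp

end OfPath

/-- `ofPath ∘ toPath = id`. [folklore] -/
@[simp]
theorem ofPath_toPath (u : C(I × (M → I), X)) (hu : ∀ p ∈ jSet M, u p = x) :
    ofPath (toPath u hu) = u := by
  ext ⟨t, y⟩
  rfl

/-! ### Homotopies rel the boundary of the cylinder versus homotopies of paths rel endpoints -/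

section Homotopies

variable {u v : C(I × (M → I), X)} (hu : ∀ p ∈ jSet M, u p = x) (hv : ∀ p ∈ jSet M, v p = x)

/-- **From the cylinder to paths**: a homotopy `u ≃ v` rel `∂(I × Iᴹ)` gives a homotopy rel
`{0, 1}` between the paths of slices, as maps `I → Ω^M X x` (the analogue of
`GenLoop.homotopicTo`). [folklore] -/
theorem homotopicRel_toPath (h : u.HomotopicRel v (cylBd M)) :
    (toPath u hu : C(I, Ω^ M X x)).HomotopicRel (toPath v hv : C(I, Ω^ M X x)) {0, 1} := by
  obtain ⟨H⟩ := h
  -- `(s, t) ↦ (y ↦ H (s, (t, y)))`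
  let K : C(I × I, C(M → I, X)) :=
    ContinuousMap.curry ⟨fun q : (I × I) × (M → I) => H (q.1.1, (q.1.2, q.2)),
      H.continuous.comp (by fun_prop)⟩
  have hK : ∀ (s t : I) (y : M → I), K (s, t) y = H (s, (t, y)) := fun _ _ _ => rfl
  refine ⟨{ toFun := fun st => ⟨K st, fun y hy => ?_⟩
            continuous_toFun := K.continuous.subtype_mk _
            map_zero_left := fun t => ?_
            map_one_left := fun t => ?_
            prop' := fun s t ht => ?_ }⟩
  · obtain ⟨s, t⟩ := st
    rw [hK, H.eq_fst s (show (t, y) ∈ cylBd M from Or.inr (Or.inr hy))]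
    exact hu (t, y) (Or.inr hy)
  · ext y
    show K (0, t) y = u (t, y)
    rw [hK, H.apply_zero]
  · ext y
    show K (1, t) y = v (t, y)
    rw [hK, H.apply_one]
  · ext y
    show K (s, t) y = u (t, y)
    rw [hK]
    refine H.eq_fst s (show (t, y) ∈ cylBd M from ?_)
    rcases ht with ht | ht
    · exact Or.inl ht
    · exact Or.inr (Or.inl ht)

/-- **From paths to the cylinder**: a homotopy rel `{0, 1}` between the paths of slices (as
maps `I → Ω^M X x`) gives a homotopy `u ≃ v` rel `∂(I × Iᴹ)` (the analogue of
`GenLoop.homotopicFrom`). [folklore] -/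
theorem homotopicRel_of_toPath
    (h : (toPath u hu : C(I, Ω^ M X x)).HomotopicRel (toPath v hv : C(I, Ω^ M X x)) {0, 1}) :
    u.HomotopicRel v (cylBd M) := by
  obtain ⟨K⟩ := h
  have hcont : Continuous fun q : I × (I × (M → I)) => (K (q.1, q.2.1) : Ω^ M X x) q.2.2 :=
    continuous_eval.comp ((K.continuous.comp (continuous_fst.prodMk
      (continuous_fst.comp continuous_snd))).prodMk (continuous_snd.comp continuous_snd))
  refine ⟨{ toFun := fun q => (K (q.1, q.2.1) : Ω^ M X x) q.2.2
            continuous_toFun := hcont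
            map_zero_left := fun q => ?_
            map_one_left := fun q => ?_
            prop' := fun s q hq => ?_ }⟩
  · show (K (0, q.1) : Ω^ M X x) q.2 = u q
    rw [K.apply_zero]; rfl
  · show (K (1, q.1) : Ω^ M X x) q.2 = v q
    rw [K.apply_one]; rfl
  · obtain ⟨t, y⟩ := q
    show (K (s, t) : Ω^ M X x) y = u (t, y)
    rcases hq with ht | ht | hy
    · dsimp only at ht; subst ht
      rw [K.eq_fst s (show (0 : I) ∈ ({0, 1} : Set I) from Or.inl rfl)]; rfl
    · dsimp only at ht; subst ht
      rw [K.eq_fst s (show (1 : I) ∈ ({0, 1} : Set I) from Or.inr rfl)]; rfl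
    · rw [GenLoop.boundary (K (s, t)) y hy, hu (t, y) (Or.inr hy)]

/-- The two transfers combined: `u ≃ v rel ∂(I × Iᴹ)` iff the slice paths are homotopic rel
endpoints. [folklore] -/
theorem homotopicRel_iff_toPath :
    u.HomotopicRel v (cylBd M) ↔
      (toPath u hu : C(I, Ω^ M X x)).HomotopicRel (toPath v hv : C(I, Ω^ M X x)) {0, 1} :=
  ⟨homotopicRel_toPath hu hv, homotopicRel_of_toPath hu hv⟩

end Homotopies

/-- For genuine paths `γ₁ γ₂ : Path a b`, `Path.Homotopic` is the relation "homotopic rel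
`{0, 1}` as maps `I → X`" (definitionally). [folklore] -/
theorem path_homotopic_iff_homotopicRel {Y : Type*} [TopologicalSpace Y] {a b : Y}
    (γ₁ γ₂ : Path a b) :
    γ₁.Homotopic γ₂ ↔ (γ₁ : C(I, Y)).HomotopicRel (γ₂ : C(I, Y)) {0, 1} := Iff.rfl

/-! ### Homotopy classes of generalized loops are path components of `Ω^M X x` -/

/-- **`π_M(X, x) = π₀(Ω^M X x)` as sets**: two generalized loops are homotopic rel `∂Iᴹ` iff
they are joined by a path in the space `Ω^M X x` of generalized loops (currying a homotopy rel
`∂Iᴹ` gives a path of generalized loops and conversely; Hatcher 2002, p. 340, `πₙ` as path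
components of a loop space). [folklore] -/
theorem genLoop_homotopic_iff_joined (p q : Ω^ M X x) : GenLoop.Homotopic p q ↔ Joined p q := by
  constructor
  · rintro ⟨H⟩
    refine ⟨{ toFun := fun t => ⟨H.toContinuousMap.curry t, fun y hy => ?_⟩
              continuous_toFun := H.toContinuousMap.curry.continuous.subtype_mk _
              source' := ?_
              target' := ?_ }⟩
    · show H (t, y) = x
      rw [H.eq_fst t hy]
      exact p.2 y hy
    · ext y
      exact H.apply_zero y
    · ext y
      exact H.apply_one y
  · rintro ⟨γ⟩
    refine ⟨{ toFun := fun q => (γ q.1 : Ω^ M X x) q.2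
              continuous_toFun := continuous_eval.comp
                ((γ.continuous.comp continuous_fst).prodMk continuous_snd)
              map_zero_left := fun y => by simp
              map_one_left := fun y => by simp
              prop' := fun t y hy => ?_ }⟩
    show (γ t : Ω^ M X x) y = p y
    rw [GenLoop.boundary (γ t) y hy]
    exact (GenLoop.boundary p y hy).symm

end GenLoopPath

end Literature.AlgebraicTopology.Homotopy

end
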